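import Summits.Ventures.Crystal3D.Theorems.StickyWulffConstantCoaxialWallLawTailResidueDefsU
import Summits.Ventures.Crystal3D.Theorems.StickyWulffConstantCoaxialWallLawEndRowTransAFloor
import HarnessLib

/-!
# The END-POOL consumer of the seam residual: `EndPools p₀ k₀ → √6 ≤ p₀ → SeamResidual (2√6) k₀`
# (crux `CoaxialWallLaw`, stmt-Ventures-19481; line `WallLedgerF`, skeleton 'CoaxialWallLawCertificates' v5, stub `stub_seamResidual`; cf-p1 (ccxvii)(A)(L3))

HONEST FRAMING. Venture `Summits/Ventures/Crystal3D` (cell `crystal3d-full`); DEFINITION + one-screen consumer for the crux `CoaxialWallLaw` (stmt-Ventures-19481,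
`route-Ventures-StickyWulffConstant`), registered line 'Certificates' v5.  Nothing substantive is claimed; F-C1 not moved.  cf-p1 (ccxvii)(A): the reading-junk
remainder of T5b is consumed in POOL-AT-END-BALLS form.  This file fixes that form and proves the one-line consumer, so that the motif numerics (19481-p1 g17,
cf-p2) measure exactly the right ratio:
* **`EndPools p₀ k₀`** — at every payer window of the seam residual (the hypotheses of `SeamResidual · k₀` verbatim: `1`-separated, `deg z ≤ 11`, off-site,
  not mono-module, `k₀ < deg z`, `¬ JammedOneAt`), unless a deletion lands on-site, EVERY loaded ball `b` within `1` of the payer has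
  `p₀ · endMultA X b ≤ pooledDef X b` (joint (A)-multiplicity of the frame `L`);
* **`seamResidual_of_endPools : EndPools p₀ k₀ → √6 ≤ p₀ → SeamResidual (2√6) k₀`** — the payer touches at most `11` balls, so at most `12` balls are
  loaded within `1` of it, each contributing `e/p ≤ 1/p₀`: `Σ_A ≤ 12/p₀ ≤ 12/√6 = 2√6`.  (The ratio to certify is therefore `p₀ ≥ √6 ≈ 2.449`, slightly
  weaker than the `13/(2√6)` quoted on the bus, because the payer's own ball is one of at most `12`, not `13`.)
WHAT THIS IS NOT: no proof of `EndPools`; F-C1 not moved.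
-/

noncomputable section

namespace Summit.Ventures.Crystal3D.Theorems

namespace TailResidue

open Summit.Ventures.Crystal3D Finset
open scoped InnerProductSpace

open scoped Classical in
/-- **END POOLS at ratio `p₀`** on the seam residual (cut `k₀`): at every payer window satisfying the hypotheses of `SeamResidual · k₀`, either a deletion of
inessential balls lands on-site, or every loaded ball `b` within `1` of the payer has `p₀ · endMultA X b ≤ pooledDef X b` for the joint systems of `L`. -/
def EndPools (p₀ : ℝ) (k₀ : ℕ) : Prop :=
  ∀ L : EuclideanSpace ℝ (Fin 3) ≃ₗᵢ[ℝ] EuclideanSpace ℝ (Fin 3),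
  ∀ X : Finset (EuclideanSpace ℝ (Fin 3)), (∀ p ∈ X, ∀ q ∈ X, p ≠ q → 1 ≤ dist p q) →
  ∀ z ∈ X, (X.filter fun q => dist z q = 1).card ≤ 11 → ¬ OnSiteAt coaxialModuleUniverse X z → ¬ MonoModuleAt L X z →
    k₀ < (X.filter fun q => dist z q = 1).card → ¬ JammedOneAt X z →
    HasDeletionOnSite X z ∨
      ∀ b ∈ X, dist z b ≤ 1 →
        p₀ * (endMultA X WordVersion.v2 (basalSystem L) (basalSystem (((ℝ ∙ EuclideanSpace.single (2 : Fin 3) (1 : ℝ)).reflection).trans L)) b : ℝ) ≤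
          pooledDef X b

open scoped Classical in
/-- At most `deg z + 1` balls lie within distance `1` of a ball `z` of a `1`-separated configuration. -/
theorem card_closedBall_one_le {X : Finset (EuclideanSpace ℝ (Fin 3))} (hX : ∀ p ∈ X, ∀ q ∈ X, p ≠ q → 1 ≤ dist p q)
    {z : EuclideanSpace ℝ (Fin 3)} (hz : z ∈ X) :
    (X.filter fun b => dist z b ≤ 1).card ≤ (X.filter fun q => dist z q = 1).card + 1 := by
  have hsub : X.filter (fun b => dist z b ≤ 1) ⊆ insert z (X.filter fun q => dist z q = 1) := by
    intro b hb
    obtain ⟨hbX, hd⟩ := mem_filter.1 hb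
    by_cases hbz : b = z
    · exact mem_insert.2 (Or.inl hbz)
    · exact mem_insert_of_mem (mem_filter.2 ⟨hbX, le_antisymm hd (hX z hz b hbX (Ne.symm hbz))⟩)
  exact (card_le_card hsub).trans (card_insert_le _ _)

open scoped Classical in
/-- **THE END-POOL CONSUMER**: `EndPools p₀ k₀ → √6 ≤ p₀ → SeamResidual (2√6) k₀`. -/
theorem seamResidual_of_endPools {p₀ : ℝ} {k₀ : ℕ} (hE : EndPools p₀ k₀) (hp₀ : Real.sqrt 6 ≤ p₀) : SeamResidual (2 * Real.sqrt 6) k₀ := by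
  intro L X hX z hz hdeg hoff hM hk hJ
  rcases hE L X hX z hz hdeg hoff hM hk hJ with hdel | hpool
  · exact Or.inl hdel
  right
  have h6 : 0 < Real.sqrt 6 := Real.sqrt_pos.2 (by norm_num)
  have hp : 0 < p₀ := lt_of_lt_of_le h6 hp₀
  unfold localSummandA
  set S₁ := basalSystem L
  set S₂ := basalSystem (((ℝ ∙ EuclideanSpace.single (2 : Fin 3) (1 : ℝ)).reflection).trans L)
  set A := X.filter (fun b => dist z b ≤ 1 ∧ 0 < endMultA X WordVersion.v2 S₁ S₂ b) with hA
  -- each loaded ball contributes at most `1/p₀`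
  have hterm : ∀ b ∈ A, (endMultA X WordVersion.v2 S₁ S₂ b : ℝ) / pooledDef X b ≤ 1 / p₀ := by
    intro b hb
    obtain ⟨hbX, hzb, hepos⟩ := mem_filter.1 hb
    have hle := hpool b hbX hzb
    have he : (0 : ℝ) < (endMultA X WordVersion.v2 S₁ S₂ b : ℝ) := by exact_mod_cast hepos
    have hP : 0 < pooledDef X b := lt_of_lt_of_le (mul_pos hp he) hle
    rw [div_le_div_iff₀ hP hp, one_mul, mul_comm]
    exact hle
  -- at most `12` loaded balls
  have hcard : (A.card : ℝ) ≤ 12 := by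
    have h1 : A.card ≤ (X.filter fun b => dist z b ≤ 1).card := card_le_card fun b hb => mem_filter.2 ⟨(mem_filter.1 hb).1, (mem_filter.1 hb).2.1⟩
    have h2 := card_closedBall_one_le hX hz
    have : A.card ≤ 12 := by omega
    exact_mod_cast this
  calc ∑ b ∈ A, (endMultA X WordVersion.v2 S₁ S₂ b : ℝ) / pooledDef X b ≤ ∑ b ∈ A, 1 / p₀ := sum_le_sum hterm
    _ = A.card * (1 / p₀) := by rw [sum_const, nsmul_eq_mul]
    _ ≤ 12 * (1 / p₀) := by gcongr
    _ ≤ 12 * (1 / Real.sqrt 6) := by gcongr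
    _ = 2 * Real.sqrt 6 := by
        have h : Real.sqrt 6 * Real.sqrt 6 = 6 := Real.mul_self_sqrt (by norm_num)
        field_simp
        linarith

end TailResidue

end Summit.Ventures.Crystal3D.Theorems

end
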